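import Literature.InformationTheory.QuantumCodes.ShadowBoundCoefficients
import Literature.InformationTheory.QuantumCodes.ShadowTransformBasis
import Literature.InformationTheory.QuantumCodes.QuantumMacWilliams
import Literature.InformationTheory.QuantumCodes.AdditiveCodeProjection
import Literature.InformationTheory.QuantumCodes.LinearProgrammingBoundAdditive
import HarnessLib

/-!
# Rains's shadow bounds on the minimum distance of quantum codes — proofs

Topic `Literature/InformationTheory/QuantumCodes` (venture QEC, cell `qec`, PARTITION row 06; LADDER-QEC rung X1
«LP/shadow upper bounds»). This file DISCHARGES the three shadow-enumerator named facts of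
`WeightEnumeratorBounds.lean`:

* `Rains1999_shadowDistanceBound_holds` — [Rains1999Shadow, Thm. 15]: a `((n,K,d))` with `K > 1` has
  `d ≤ 2⌊(n+1)/6⌋ + 1`, `+2` for `n ≡ 4 (mod 6)`;
* `Rains1998_theorem9_shadowBound_holds` — [Rains1998Shadow, Thm. 9]: the same for additive `[[n,k,d]]`, `k ≥ 1`;
* `Rains1998_theorem6_selfDual_holds` — [Rains1998Shadow, Thm. 6]: a self-dual additive `[[n,0,d]]`, `n ≥ 1`, has
  `d ≤ 2⌊n/6⌋ + 2`, `+3` for `n ≡ 5 (mod 6)`;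
and proves the general-code companion `Rains1999_theorem14_pureSelfDual` — [Rains1999Shadow, Thm. 14]: the same bound
for every pure `((n,1,d))`, `n ≥ 1` — and the «In particular» clause of Thm. 15, `Rains1999_theorem15_correctableErrors`:
a `((n,K,d))`, `K > 1`, corrects at most `⌊(n+1)/6⌋` errors (`⌊(d−1)/2⌋ ≤ ⌊(n+1)/6⌋`).

Route (the printed one, [Rains1998Shadow, §V]; «the proof makes no assumptions of integrality, so carries over
directly» [Rains1999Shadow, remark at Thm. 14]): each bound is the infeasibility of the corresponding LINEAR system —
Rains's LP with shadow inequalities `RainsLPFeasible n K d` (all codes, via the proved `Rains1999_LPBound_holds` and,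
for additive codes, the proved bridge `IsAdditiveCode.exists_isCodeProjection`), resp. `RainsLPFeasiblePure n 1 d`
(self-dual codes, via the proved `IsAdditiveCode.rainsLPFeasiblePure_zero`) — exhibited by an explicit dual
functional: Rains's coefficient `e_i` (resp. `c_i`; the combinations `e_{i+1} + 4e_i`, `c_{i+1} + 4c_i` for
`n ≡ 4`, resp. `5 (mod 6)`) of the anti-invariant (resp. invariant) expansion of `Δ = A − A∘T` (resp. of `A`), which
is a NONNEGATIVE combination, with positive weight on `A_0`, of the first `d` coefficients on the `A`-side and a
combination of fixed sign of the shadow coefficients `S_j ≥ 0` [Rains1998Shadow, §V proof of Thm. 9; §IV proof of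
Thm. 6]. Steps: `serFun`/`sumFun` (the two sides as `ℝ`-linear functionals on `ℝ[y]`);
`antiFun_eq_shadowFun_eigVec` / `invFun_eq_invShadowFun_eigVec` (the coefficient identity on the eigenbasis
`(1+y)^{n−a}(1−3y)^a`, from `coeff_antiInvariant_basis`, `macT_eigVec`, `shT_eigVec`); extension to all polynomials
of degree `≤ n` by `mem_span_eigVec`; the LP theorems `rainsLP_shadow_bound` (`K ≥ 2`) and
`rainsLPPure_shadow_bound` (`K = 1`, pure); the three discharges.

References: E. M. Rains, *Shadow bounds for self-dual codes*, IEEE Trans. Inform. Theory 44 (1998) 134–139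
[Rains1998Shadow]; E. M. Rains, *Quantum shadow enumerators*, IEEE Trans. Inform. Theory 45 (1999) 2361–2366
[Rains1999Shadow].
-/

namespace Literature.InformationTheory.QuantumCodes

open Finset Polynomial

noncomputable section

namespace ShadowBound

/-! ### Linear functionals on `ℝ[y]` -/

/-- The **series functional** `D ↦ [yⁱ](D(y)·Φ(y))` for a fixed formal power series `Φ` (Rains's `e_i`/`c_i`
written on the `A`-side: `Φ = (1+y)^{2i−n}(1−y)^{−i−1}`, resp. `(1−3y)(1+y)^{2i−1−n}(1−y)^{−i−1}`). Column:
definition (auxiliary). [cite: Rains1998Shadow, §V p. 138 («φ_{ij} = [coeff. of y^{i−j} in (1+y)^{2i−n}(1−y)^{−i−1}]»)] -/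
def serFun (Φ : PowerSeries ℝ) (i : ℕ) : ℝ[X] →ₗ[ℝ] ℝ where
  toFun D := PowerSeries.coeff i ((D : PowerSeries ℝ) * Φ)
  map_add' D E := by simp only [Polynomial.coe_add, add_mul, map_add]
  map_smul' c D := by
    rw [Polynomial.coe_smul, smul_mul_assoc, map_smul, RingHom.id_apply]

/-- `serFun` unfolded. [cite: Rains1998Shadow, §V p. 138] -/
theorem serFun_apply (Φ : PowerSeries ℝ) (i : ℕ) (D : ℝ[X]) :
    serFun Φ i D = PowerSeries.coeff i ((D : PowerSeries ℝ) * Φ) := rfl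

/-- `serFun Φ i D = Σ_{j ≤ i} D_j · [y^{i−j}]Φ`. [cite: Rains1998Shadow, §V p. 138] -/
theorem serFun_eq_sum (Φ : PowerSeries ℝ) (i : ℕ) (D : ℝ[X]) :
    serFun Φ i D = ∑ j ∈ range (i + 1), D.coeff j * PowerSeries.coeff (i - j) Φ := by
  rw [serFun_apply, PowerSeries.coeff_mul, Nat.sum_antidiagonal_eq_sum_range_succ_mk]
  simp_rw [Polynomial.coeff_coe]

/-- The **coefficient-sum functional** `D ↦ Σ_{j ≤ k} w_j · D_{2j+t}` (Rains's `e_i`/`c_i` written on the shadow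
side, weights `γ_{ij} = (−1)^i 2^{3i−n−r+1} C(k−j,i)`, resp. `β_{ij} = (−1)^i 2^{3i−n} C(k−j,i)`). Column: definition
(auxiliary). [cite: Rains1998Shadow, §IV–V p. 138 (formulas for β_{ij}, γ_{ij})] -/
def sumFun (w : ℕ → ℝ) (t k : ℕ) : ℝ[X] →ₗ[ℝ] ℝ :=
  ∑ j ∈ range (k + 1), w j • lcoeff ℝ (2 * j + t)

/-- `sumFun` unfolded. [cite: Rains1998Shadow, §V p. 138] -/
theorem sumFun_apply (w : ℕ → ℝ) (t k : ℕ) (D : ℝ[X]) :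
    sumFun w t k D = ∑ j ∈ range (k + 1), w j * D.coeff (2 * j + t) := by
  simp only [sumFun, LinearMap.sum_apply, LinearMap.smul_apply, lcoeff_apply, smul_eq_mul]

/-- Coercion of the eigenbasis into power series. [cite: Rains1998Shadow, Thm. 7 p. 138] -/
theorem coe_eigVec (n a : ℕ) :
    ((eigVec n a : ℝ[X]) : PowerSeries ℝ) = (1 + PowerSeries.X) ^ (n - a) * (1 - 3 * PowerSeries.X) ^ a := by
  rw [eigVec, Polynomial.coe_mul, Polynomial.coe_pow, Polynomial.coe_pow, Polynomial.coe_add,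
    Polynomial.coe_sub, Polynomial.coe_one, Polynomial.coe_mul, Polynomial.coe_X,
    show (3 : ℝ[X]) = C 3 from (map_ofNat C 3).symm, Polynomial.coe_C, map_ofNat]

/-- `sumFun` on `2^n · y^{n−a}` picks out the index `j` with `2j + t = n − a`, if any. [folklore] -/
private theorem sumFun_C_mul_X_pow (w : ℕ → ℝ) (t k n a : ℕ) :
    sumFun w t k (C ((2 : ℝ) ^ n) * X ^ (n - a))
      = ∑ j ∈ range (k + 1), if 2 * j + t = n - a then w j * 2 ^ n else 0 := by
  rw [sumFun_apply]
  refine sum_congr rfl fun j _ => ?_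
  rw [coeff_C_mul, coeff_X_pow]
  split_ifs <;> simp

/-- A sum of the shape `Σ_{j ≤ k} [2j + t = 2(k−b) + t]·g j` collapses to `g (k − b)` (`b ≤ k`). [folklore] -/
private theorem sum_ite_index_eq {k t b : ℕ} (hb : b ≤ k) (g : ℕ → ℝ) {N : ℕ} (hN : N = 2 * (k - b) + t) :
    (∑ j ∈ range (k + 1), if 2 * j + t = N then g j else 0) = g (k - b) := by
  rw [sum_congr rfl fun j _ => show (if 2 * j + t = N then g j else 0) = if j = k - b then g j else 0 by
      by_cases h : j = k - b
      · rw [if_pos h, if_pos (by omega)]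
      · rw [if_neg h, if_neg (by omega)],
    sum_ite_eq']
  rw [if_pos (mem_range.mpr (by omega))]

/-! ### The anti-invariant functional identity (Thm. 9 / Thm. 15) -/

/-- The `A`-side series `Φ_i = (1+y)^{3i+1−n}(1−y²)^{−(i+1)}` (`= (1+y)^{2i−n}(1−y)^{−i−1}`). Column: definition
(auxiliary). [cite: Rains1998Shadow, §V p. 138 («φ_{ij} = [coeff. of y^{i−j} in (1+y)^{2i−n}(1−y)^{−i−1}]»)] -/
def phiSeries (n i : ℕ) : PowerSeries ℝ := (1 + PowerSeries.X) ^ (3 * i + 1 - n) * wSeries i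

/-- The shadow-side weights `γ′_{ij} = (−1)^i 2^{3i+1−n} C(k−j, i)`, `k = ⌊(n−1)/2⌋` (Rains's `γ_{ij}` times
`K·2^{−n}`, with `2^r = K`). Column: definition (auxiliary).
[cite: Rains1998Shadow, §V p. 138 («γ_{ij} = (−1)^i 2^{3i−n−r+1} binom(k−j, i)»)] -/
def gammaW (n i j : ℕ) : ℝ := (-1) ^ i * 2 ^ (3 * i + 1 - n) * ((((n - 1) / 2 - j).choose i : ℕ) : ℝ)

/-- The `A`-side functional `D ↦ e_i(D − D∘T) = [yⁱ](Φ_i · (D − macT D))`. Column: definition (auxiliary).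
[cite: Rains1998Shadow, §V p. 138] -/
def antiFun (n i : ℕ) : ℝ[X] →ₗ[ℝ] ℝ := serFun (phiSeries n i) i ∘ₗ (LinearMap.id - macT n)

/-- The shadow-side functional `D ↦ Σ_j γ′_{ij} [y^{2j+t}] shT D`, `n − 1 = 2k + t`. Column: definition
(auxiliary). [cite: Rains1998Shadow, §V p. 138] -/
def shadowFun (n i : ℕ) : ℝ[X] →ₗ[ℝ] ℝ := sumFun (gammaW n i) ((n - 1) % 2) ((n - 1) / 2) ∘ₗ shT n

/-- **Rains's Thm. 7 + Lemma 8 on the eigenbasis**: for `1 ≤ n ≤ 3i + 1` and `a ≤ n`,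
`e_i` of `(x+y)^{n−a}(x−3y)^a − T(x+y)^{n−a}(x−3y)^a` equals `Σ_j γ′_{ij} S_{2j+t}((x+y)^{n−a}(x−3y)^a)`: both vanish
for even `a`, and for `a = 2b+1` both equal `2·C(b,i)(−8)^i`.
[cite: Rains1998Shadow, §V Thm. 7 and the formulas for φ_{ij}, γ_{ij} p. 138] -/
theorem antiFun_eq_shadowFun_eigVec {n i a : ℕ} (hn : 1 ≤ n) (hi : n ≤ 3 * i + 1) (ha : a ≤ n) :
    antiFun n i (eigVec n a) = shadowFun n i (eigVec n a) := by
  have hkt : n - 1 = 2 * ((n - 1) / 2) + (n - 1) % 2 := (Nat.div_add_mod (n - 1) 2).symm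
  have ht2 : (n - 1) % 2 < 2 := Nat.mod_lt _ (by norm_num)
  rw [antiFun, shadowFun, LinearMap.comp_apply, LinearMap.comp_apply, LinearMap.sub_apply, LinearMap.id_apply,
    macT_eigVec ha, shT_eigVec ha, sumFun_C_mul_X_pow,
    show eigVec n a - C ((-1 : ℝ) ^ a) * eigVec n a = (1 - (-1 : ℝ) ^ a) • eigVec n a by
      rw [smul_eq_C_mul, map_sub, map_one]; ring,
    map_smul, smul_eq_mul, serFun_apply, coe_eigVec, phiSeries]
  obtain ⟨b, rfl | rfl⟩ := Nat.even_or_odd' a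
  · -- even `a = 2b`: both sides vanish
    rw [pow_mul, neg_one_sq, one_pow, sub_self, zero_mul]
    symm
    refine sum_eq_zero fun j _ => ?_
    rw [if_neg (by omega)]
  · -- odd `a = 2b + 1`
    rw [pow_succ, pow_mul, neg_one_sq, one_pow, one_mul, sub_neg_eq_add, one_add_one_eq_two,
      show (1 + PowerSeries.X) ^ (n - (2 * b + 1)) * (1 - 3 * PowerSeries.X) ^ (2 * b + 1)
          * ((1 + PowerSeries.X) ^ (3 * i + 1 - n) * wSeries i)
        = (1 - 3 * PowerSeries.X) ^ (2 * b + 1) * (1 + PowerSeries.X) ^ (3 * i - 2 * b) * wSeries i by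
        rw [show 3 * i - 2 * b = (n - (2 * b + 1)) + (3 * i + 1 - n) by omega, pow_add]; ring,
      coeff_antiInvariant_basis b i (by omega),
      sum_ite_index_eq (show b ≤ (n - 1) / 2 by omega) _ (show n - (2 * b + 1) = 2 * ((n - 1) / 2 - b) + (n - 1) % 2
        by omega),
      gammaW, show (n - 1) / 2 - ((n - 1) / 2 - b) = b by omega, mul_assoc, mul_assoc, mul_comm _ ((2 : ℝ) ^ n),
      ← mul_assoc ((2 : ℝ) ^ _), ← pow_add, show 3 * i + 1 - n + n = 3 * i + 1 by omega, pow_succ,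
      show (-8 : ℝ) = (-1) * 2 ^ 3 by norm_num, mul_pow, ← pow_mul]
    ring

/-- **The coefficient identity `e_i = Σ_j φ_{ij} f_j = Σ_j γ_{ij} g_j`** for every enumerator of degree `≤ n`
(`1 ≤ n ≤ 3i+1`): by linearity from the eigenbasis. [cite: Rains1998Shadow, §V (Thm. 7, Lemma 8 and the two
expansions of e_i) p. 138] -/
theorem antiFun_eq_shadowFun {n i : ℕ} (hn : 1 ≤ n) (hi : n ≤ 3 * i + 1) {D : ℝ[X]} (hD : D.natDegree ≤ n) :
    antiFun n i D = shadowFun n i D :=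
  LinearMap.eqOn_span (s := eigVec n '' {a | a ≤ n})
    (by rintro _ ⟨a, ha, rfl⟩; exact antiFun_eq_shadowFun_eigVec hn hi ha) (mem_span_eigVec hD)

/-! ### Two elementary binomial inequalities (signs of the combined certificates) -/

/-- `2·C(N, 2m) ≤ C(N, 2m−1)` for `N ≤ 3m − 2` (sign of `γ_{(2m)j} + 4γ_{(2m−1)j}` in the case `n ≡ 4 (mod 6)`:
«γ_{(2m)j} + 4γ_{(2m−1)j} … < 0»). [cite: Rains1998Shadow, §V p. 138] -/
theorem two_mul_choose_two_mul_le {m N : ℕ} (hm : 1 ≤ m) (hN : N + 2 ≤ 3 * m) :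
    2 * N.choose (2 * m) ≤ N.choose (2 * m - 1) := by
  obtain ⟨m, rfl⟩ := Nat.exists_eq_add_of_le hm
  rw [show 2 * (1 + m) - 1 = 2 * m + 1 by omega, show 2 * (1 + m) = 2 * m + 1 + 1 by omega]
  have h := Nat.choose_succ_right_eq N (2 * m + 1)
  set c1 := N.choose (2 * m + 1 + 1)
  set c2 := N.choose (2 * m + 1)
  have he : N - (2 * m + 1) ≤ m := by omega
  have hmain : c1 * (2 * m + 2) ≤ c2 * m := by
    calc c1 * (2 * m + 2) = c1 * (2 * m + 1 + 1) := by ring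
      _ = c2 * (N - (2 * m + 1)) := h
      _ ≤ c2 * m := Nat.mul_le_mul_left _ he
  rcases Nat.eq_zero_or_pos m with rfl | hm0
  · have : c1 = 0 := by simpa using hmain
    omega
  · have h2 : 2 * c1 * m ≤ c2 * m := by nlinarith
    exact Nat.le_of_mul_le_mul_right h2 hm0

/-- `2·C(N, 2M+1) ≤ C(N, 2M)` for `N ≤ 3M − 1` (sign of `β_{(2M+1)j} + 4β_{(2M)j}` in the case `n ≡ 5 (mod 6)`:
«α_{2m+1}β_{(2m)j} − α_{2m}β_{(2m+1)j} … ≥ 0»). [cite: Rains1998Shadow, §IV p. 138] -/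
theorem two_mul_choose_two_mul_add_one_le {M N : ℕ} (hM : 1 ≤ M) (hN : N + 1 ≤ 3 * M) :
    2 * N.choose (2 * M + 1) ≤ N.choose (2 * M) := by
  obtain ⟨M, rfl⟩ := Nat.exists_eq_add_of_le hM
  have h := Nat.choose_succ_right_eq N (2 * (1 + M))
  set c1 := N.choose (2 * (1 + M) + 1)
  set c2 := N.choose (2 * (1 + M))
  have he : N - 2 * (1 + M) ≤ M := by omega
  have hmain : c1 * (2 * M + 3) ≤ c2 * M := by
    calc c1 * (2 * M + 3) = c1 * (2 * (1 + M) + 1) := by ring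
      _ = c2 * (N - 2 * (1 + M)) := h
      _ ≤ c2 * M := Nat.mul_le_mul_left _ he
  rcases Nat.eq_zero_or_pos M with rfl | hM0
  · have : c1 = 0 := by simpa using hmain
    omega
  · have h2 : 2 * c1 * M ≤ c2 * M := by nlinarith
    exact Nat.le_of_mul_le_mul_right h2 hM0

/-! ### The LP theorem for `K ≥ 2` (Rains 1999 Thm. 15 / 1998 Thm. 9) -/

/-- **Infeasibility of Rains's LP beyond the shadow bound.** If Rains's linear system with shadow inequalities
`RainsLPFeasible n K d` (Thm. 10 of [Rains1999Shadow]) has a solution with `K ≥ 2`, then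
`d ≤ 2⌊(n+1)/6⌋ + 1`, `+2` instead of `+1` when `n ≡ 4 (mod 6)`. This is the LP-duality content of the printed
proof of [Rains1998Shadow, Thm. 9] («we need to find a nonnegative linear combination of the coefficients of
`B(x,y) − A(x,y)`, `A(x,y)` and `S(x,y)` that equals 0, producing a contradiction»), with the dual certificate
`e_{2m+1}` (`n = 6m−1+l`, `l ≤ 4`), resp. `e_{2m+2} + 4e_{2m+1}` (`l = 5`).
[cite: Rains1998Shadow, §V Thm. 9 (proof) p. 138; Rains1999Shadow, Thm. 15 p. 2365] -/
theorem rainsLP_shadow_bound {n K d : ℕ} (hK : 2 ≤ K) (h : RainsLPFeasible n K d) :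
    d ≤ 2 * ((n + 1) / 6) + (if n % 6 = 4 then 2 else 1) := by
  obtain ⟨A, hA0, hAnn, hAeq, -, hS⟩ := h
  by_contra hd
  rw [not_le] at hd
  have hd1 : 1 ≤ d := by split_ifs at hd <;> omega
  have hKr : (1 : ℝ) < K := by exact_mod_cast (show 1 < K by omega)
  have hK0 : (K : ℝ) ≠ 0 := by positivity
  rcases Nat.eq_zero_or_pos n with rfl | hn
  · -- `n = 0`: the constraint `A_0 = K·B_0 = K·A_0` already fails
    have h0 := hAeq 0 hd1
    have hB : rainsDual 0 A 0 = A 0 := by simp [rainsDual, krawtchouk4]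
    rw [hB, hA0] at h0
    have : (K : ℝ) ^ 2 * (K - 1) = 0 := by linear_combination -h0
    rcases mul_eq_zero.mp this with h1 | h1
    · exact hK0 (pow_eq_zero_iff (two_ne_zero) |>.mp h1)
    · linarith
  -- `n ≥ 1`: the dual certificate
  set D := ofCoeffs n A with hD
  have hDdeg : D.natDegree ≤ n := natDegree_ofCoeffs_le n A
  set f : ℕ → ℝ := fun j => (D - macT n D).coeff j with hf
  have hf_le : ∀ j, j ≤ n → j < d → f j = A j * (1 - 1 / K) := by
    intro j hj hjd
    have := hAeq j hjd
    rw [hf]; dsimp only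
    rw [coeff_sub, coeff_macT_ofCoeffs, coeff_ofCoeffs, if_pos hj]
    field_simp
    linear_combination this
  have hf_nonneg : ∀ j, j < d → 0 ≤ f j := by
    intro j hjd
    by_cases hj : j ≤ n
    · rw [hf_le j hj hjd]
      exact mul_nonneg (hAnn j hj) (by rw [sub_nonneg, div_le_one (by positivity)]; exact hKr.le)
    · rw [hf]; dsimp only
      rw [coeff_sub, coeff_eq_zero_of_natDegree_lt (by omega),
        coeff_eq_zero_of_natDegree_lt ((natDegree_macT_le n D).trans_lt (by omega)), sub_zero]
  have hf0 : 0 < f 0 := by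
    rw [hf_le 0 (Nat.zero_le n) hd1, hA0]
    exact mul_pos (by positivity) (by rw [sub_pos, div_lt_one (by positivity)]; exact hKr)
  have hanti : ∀ i, antiFun n i D = ∑ j ∈ range (i + 1), f j * PowerSeries.coeff (i - j) (phiSeries n i) := by
    intro i; rw [antiFun, LinearMap.comp_apply, serFun_eq_sum]; rfl
  have hshadow : ∀ i, shadowFun n i D
      = ∑ j ∈ range ((n - 1) / 2 + 1), gammaW n i j * rainsShadow n A (2 * j + (n - 1) % 2) := by
    intro i; rw [shadowFun, LinearMap.comp_apply, sumFun_apply]; simp_rw [hD, coeff_shT_ofCoeffs]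
  have hkt : n - 1 = 2 * ((n - 1) / 2) + (n - 1) % 2 := (Nat.div_add_mod (n - 1) 2).symm
  have hSnn : ∀ j ∈ range ((n - 1) / 2 + 1), 0 ≤ rainsShadow n A (2 * j + (n - 1) % 2) := by
    intro j hj; rw [mem_range] at hj; exact hS _ (by omega)
  -- the A-side is ≥ f₀·[yⁱ]Φ_i, and all its terms are ≥ 0, as long as i + 1 ≤ d
  have hanti_ge : ∀ i, i + 1 ≤ d → f 0 * PowerSeries.coeff i (phiSeries n i) ≤ antiFun n i D := by
    intro i hid
    rw [hanti]
    have := Finset.single_le_sum (f := fun j => f j * PowerSeries.coeff (i - j) (phiSeries n i))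
      (fun j hj => mul_nonneg (hf_nonneg j (by rw [mem_range] at hj; omega))
        (coeff_one_add_X_pow_mul_wSeries_nonneg _ _ _)) (mem_range.mpr (Nat.succ_pos i))
    simpa using this
  have hshadow_odd : ∀ i, Odd i → shadowFun n i D ≤ 0 := by
    intro i hi
    rw [hshadow]
    refine sum_nonpos fun j hj => mul_nonpos_of_nonpos_of_nonneg ?_ (hSnn j hj)
    rw [gammaW, hi.neg_one_pow]
    have : (0 : ℝ) ≤ 2 ^ (3 * i + 1 - n) * ((((n - 1) / 2 - j).choose i : ℕ) : ℝ) := by positivity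
    linarith
  -- write n = 6m − l with 2 ≤ l ≤ 7
  set m := (n + 7) / 6 with hm
  have hm1 : 1 ≤ m := by omega
  have hl : 6 * m - 7 ≤ n ∧ n + 2 ≤ 6 * m := by omega
  by_cases hl2 : n = 6 * m - 2
  · -- `n ≡ 4 (mod 6)`: certificate `e_{2m} + 4 e_{2m−1}`, bound `2m`
    have hbound : 2 * m + 1 ≤ d := by
      have : n % 6 = 4 := by omega
      rw [if_pos this] at hd; omega
    have hI1 := antiFun_eq_shadowFun hn (show n ≤ 3 * (2 * m - 1) + 1 by omega) hDdeg
    have hI2 := antiFun_eq_shadowFun hn (show n ≤ 3 * (2 * m) + 1 by omega) hDdeg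
    have hA1 : 0 ≤ antiFun n (2 * m - 1) D :=
      le_trans (mul_nonneg hf0.le (coeff_one_add_X_pow_mul_wSeries_nonneg _ _ _)) (hanti_ge _ (by omega))
    have hA2 : 0 < antiFun n (2 * m) D :=
      lt_of_lt_of_le (mul_pos hf0 (coeff_one_add_X_pow_mul_wSeries_pos (Or.inr (by omega))))
        (hanti_ge _ (by omega))
    have hB : shadowFun n (2 * m) D + 4 * shadowFun n (2 * m - 1) D ≤ 0 := by
      rw [hshadow, hshadow, mul_sum, ← sum_add_distrib]
      refine sum_nonpos fun j hj => ?_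
      rw [mem_range] at hj
      rw [← mul_assoc, ← add_mul]
      refine mul_nonpos_of_nonpos_of_nonneg ?_ (hSnn j (mem_range.mpr hj))
      rw [gammaW, gammaW, show 3 * (2 * m) + 1 - n = 3 by omega, show 3 * (2 * m - 1) + 1 - n = 0 by omega,
        show (-1 : ℝ) ^ (2 * m) = 1 by rw [pow_mul, neg_one_sq, one_pow],
        show (-1 : ℝ) ^ (2 * m - 1) = -1 by rw [show 2 * m - 1 = 2 * (m - 1) + 1 by omega, pow_succ, pow_mul,
          neg_one_sq, one_pow, one_mul]]
      have hc := two_mul_choose_two_mul_le (N := (n - 1) / 2 - j) hm1 (by omega)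
      have hc' : (2 : ℝ) * (((n - 1) / 2 - j).choose (2 * m) : ℕ) ≤ (((n - 1) / 2 - j).choose (2 * m - 1) : ℕ) := by
        exact_mod_cast hc
      linarith
    linarith
  · -- `n ≢ 4 (mod 6)`: certificate `e_{2m−1}`, bound `2m − 1`
    have hbound : 2 * m ≤ d := by
      have : n % 6 ≠ 4 := by omega
      rw [if_neg this] at hd; omega
    have hI := antiFun_eq_shadowFun hn (show n ≤ 3 * (2 * m - 1) + 1 by omega) hDdeg
    have hA : 0 < antiFun n (2 * m - 1) D :=
      lt_of_lt_of_le (mul_pos hf0 (coeff_one_add_X_pow_mul_wSeries_pos (Or.inr (by omega))))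
        (hanti_ge _ (by omega))
    have hB := hshadow_odd (2 * m - 1) ⟨m - 1, by omega⟩
    linarith

/-! ### The invariant functional identity and the LP theorem for self-dual codes (Rains 1998 Thm. 6) -/

/-- The `A`-side series `Ψ_i = (1−3y)(1+y)^{3i−n}(1−y²)^{−(i+1)}` (`= (1−3y)(1+y)^{2i−1−n}(1−y)^{−i−1}`, Lemma 8
form of the coefficient `c_i` of Thm. 4). Column: definition (auxiliary).
[cite: Rains1998Shadow, §IV p. 138 and §V Lemma 8 («κ_{ij} = [coeff. of x^{i−j} in (x g′/g) f (x/g)^i]»)] -/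
def psiSeries (n i : ℕ) : PowerSeries ℝ :=
  (1 - 3 * PowerSeries.X) * (1 + PowerSeries.X) ^ (3 * i - n) * wSeries i

/-- The shadow-side weights `β_{ij} = (−1)^i 2^{3i−n} C(k−j, i)`, `k = ⌊n/2⌋`. Column: definition (auxiliary).
[cite: Rains1998Shadow, §IV p. 138 («β_{ij}(n) = (−1)^i 2^{3i−n} binom(k−j, i)»)] -/
def betaW (n i j : ℕ) : ℝ := (-1) ^ i * 2 ^ (3 * i - n) * (((n / 2 - j).choose i : ℕ) : ℝ)

/-- The `A`-side functional `D ↦ c_i(D + D∘T)` (symmetrised, so that it vanishes on anti-invariants). Column: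
definition (auxiliary). [cite: Rains1998Shadow, §IV p. 138] -/
def invFun (n i : ℕ) : ℝ[X] →ₗ[ℝ] ℝ := serFun (psiSeries n i) i ∘ₗ (LinearMap.id + macT n)

/-- The shadow-side functional `D ↦ Σ_j β_{ij} [y^{2j+t}] shT (D + D∘T)`, `n = 2k + t`. Column: definition
(auxiliary). [cite: Rains1998Shadow, §IV p. 138] -/
def invShadowFun (n i : ℕ) : ℝ[X] →ₗ[ℝ] ℝ := sumFun (betaW n i) (n % 2) (n / 2) ∘ₗ shT n ∘ₗ (LinearMap.id + macT n)

/-- **Rains's Thm. 4 + Lemma 8 on the eigenbasis**: for `n ≤ 3i` and `a ≤ n`, `c_i` of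
`(x+y)^{n−a}(x−3y)^a + T(x+y)^{n−a}(x−3y)^a` equals `Σ_j β_{ij} S_{2j+t}` of the same: both vanish for odd `a`,
and for `a = 2b` both equal `2·C(b,i)(−8)^i`. [cite: Rains1998Shadow, §IV (Thm. 4 expansion, α/β formulas) p. 138] -/
theorem invFun_eq_invShadowFun_eigVec {n i a : ℕ} (hi : n ≤ 3 * i) (ha : a ≤ n) :
    invFun n i (eigVec n a) = invShadowFun n i (eigVec n a) := by
  have hkt : n = 2 * (n / 2) + n % 2 := (Nat.div_add_mod n 2).symm
  have ht2 : n % 2 < 2 := Nat.mod_lt _ (by norm_num)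
  rw [invFun, invShadowFun, LinearMap.comp_apply, LinearMap.comp_apply, LinearMap.comp_apply,
    LinearMap.add_apply, LinearMap.id_apply, macT_eigVec ha,
    show eigVec n a + C ((-1 : ℝ) ^ a) * eigVec n a = (1 + (-1 : ℝ) ^ a) • eigVec n a by
      rw [smul_eq_C_mul, map_add, map_one]; ring,
    map_smul, map_smul, map_smul, smul_eq_mul, smul_eq_mul, serFun_apply, coe_eigVec, psiSeries, shT_eigVec ha,
    sumFun_C_mul_X_pow]
  obtain ⟨b, rfl | rfl⟩ := Nat.even_or_odd' a
  · -- even `a = 2b`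
    rw [pow_mul, neg_one_sq, one_pow, one_add_one_eq_two,
      show (1 + PowerSeries.X) ^ (n - 2 * b) * (1 - 3 * PowerSeries.X) ^ (2 * b)
          * ((1 - 3 * PowerSeries.X) * (1 + PowerSeries.X) ^ (3 * i - n) * wSeries i)
        = (1 - 3 * PowerSeries.X) ^ (2 * b + 1) * (1 + PowerSeries.X) ^ (3 * i - 2 * b) * wSeries i by
        rw [show 3 * i - 2 * b = (n - 2 * b) + (3 * i - n) by omega, pow_add, pow_succ]; ring,
      coeff_antiInvariant_basis b i (by omega),
      sum_ite_index_eq (show b ≤ n / 2 by omega) _ (show n - 2 * b = 2 * (n / 2 - b) + n % 2 by omega),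
      betaW, show n / 2 - (n / 2 - b) = b by omega, mul_assoc, mul_assoc, mul_comm _ ((2 : ℝ) ^ n),
      ← mul_assoc ((2 : ℝ) ^ _), ← pow_add, show 3 * i - n + n = 3 * i by omega,
      show (-8 : ℝ) = (-1) * 2 ^ 3 by norm_num, mul_pow, ← pow_mul]
    ring
  · -- odd `a = 2b + 1`: both sides vanish
    rw [pow_succ, pow_mul, neg_one_sq, one_pow, one_mul, add_neg_cancel, zero_mul, zero_mul]

/-- The invariant coefficient identity for every polynomial of degree `≤ n` (`n ≤ 3i`).
[cite: Rains1998Shadow, §IV p. 138] -/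
theorem invFun_eq_invShadowFun {n i : ℕ} (hi : n ≤ 3 * i) {D : ℝ[X]} (hD : D.natDegree ≤ n) :
    invFun n i D = invShadowFun n i D :=
  LinearMap.eqOn_span (s := eigVec n '' {a | a ≤ n})
    (by rintro _ ⟨a, ha, rfl⟩; exact invFun_eq_invShadowFun_eigVec hi ha) (mem_span_eigVec hD)

/-- `Σ_{j ≤ n} P_j(r,n) = 4^n·[r = 0]` for `r ≤ n` (the generating function at `y = 1`).
[cite: Rains1999Shadow, Thm. 10 p. 2364] -/
theorem sum_krawtchouk4_eq (n r : ℕ) (hr : r ≤ n) :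
    ∑ j ∈ range (n + 1), (krawtchouk4 n j r : ℝ) = if r = 0 then 4 ^ n else 0 := by
  have hdeg : (mwTerm n r).natDegree < n + 1 := by
    refine Nat.lt_succ_of_le ?_
    unfold mwTerm
    refine (natDegree_mul_le).trans ?_
    refine (add_le_add (natDegree_pow_le) (natDegree_pow_le)).trans ?_
    have h1 : (1 + 3 * X : ℝ[X]).natDegree ≤ 1 := by compute_degree
    have h2 : (1 - X : ℝ[X]).natDegree ≤ 1 := by compute_degree
    calc (n - r) * (1 + 3 * X : ℝ[X]).natDegree + r * (1 - X : ℝ[X]).natDegree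
        ≤ (n - r) * 1 + r * 1 := add_le_add (Nat.mul_le_mul_left _ h1) (Nat.mul_le_mul_left _ h2)
      _ = n := by omega
  have h := eval_eq_sum_range' hdeg (1 : ℝ)
  simp_rw [one_pow, mul_one, coeff_mwTerm] at h
  rw [← h, mwTerm]
  rcases Nat.eq_zero_or_pos r with rfl | hr0
  · simp; norm_num
  · rw [if_neg (by omega)]; simp [zero_pow (by omega : r ≠ 0)]

/-- **Infeasibility of Rains's pure LP (`K = 1`) beyond the self-dual shadow bound.** If `RainsLPFeasiblePure n 1 d`
has a solution and `n ≥ 1`, then `d ≤ 2⌊n/6⌋ + 2`, `+3` instead of `+2` when `n ≡ 5 (mod 6)` — the LP-duality content of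
the proof of [Rains1998Shadow, Thm. 6] (certificate `c_{2m+2}`, resp. `c_{2m+3} + 4c_{2m+2}`, whose `a_0`-weight
`α_i(n) < 0` while its shadow-side weights have the sign of `β_{ij}`), using first that the system forces
`A_i = B_i` for all `i` (invariance under the MacWilliams transform). [cite: Rains1998Shadow, §IV Thm. 6 (proof) p. 138] -/
theorem rainsLPPure_shadow_bound {n d : ℕ} (hn : 1 ≤ n) (h : RainsLPFeasiblePure n 1 d) :
    d ≤ 2 * (n / 6) + (if n % 6 = 5 then 3 else 2) := by
  obtain ⟨A, hA0, hAnn, hApure, hAeq, hAle, hS⟩ := h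
  simp only [Nat.cast_one, one_pow, one_mul] at hA0 hAeq hAle
  by_contra hd
  rw [not_le] at hd
  have hd1 : 3 ≤ d := by split_ifs at hd <;> omega
  set D := ofCoeffs n A with hD
  have hDdeg : D.natDegree ≤ n := natDegree_ofCoeffs_le n A
  -- Step 1: the system forces invariance `A_j = B_j` for all `j ≤ n`.
  have hsumA : ∑ j ∈ range (n + 1), A j = 2 ^ n := by
    have h0 := hAeq 0 (by omega)
    rw [rainsDual] at h0
    simp_rw [show ∀ r, krawtchouk4 n 0 r = 1 from fun r => by simp [krawtchouk4]] at h0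
    rw [hA0] at h0
    simp only [Int.cast_one, one_mul] at h0
    field_simp at h0
    linarith
  have hsumB : ∑ j ∈ range (n + 1), rainsDual n A j = 2 ^ n := by
    simp_rw [rainsDual]
    rw [← mul_sum, sum_comm]
    simp_rw [← sum_mul]
    rw [sum_congr rfl fun r hr => by rw [sum_krawtchouk4_eq n r (by rw [mem_range] at hr; omega)]]
    simp_rw [ite_mul, zero_mul]
    rw [sum_ite_eq', if_pos (mem_range.mpr (Nat.succ_pos n)), hA0, mul_one,
      show (4 : ℝ) ^ n = 2 ^ n * 2 ^ n by rw [← mul_pow]; norm_num]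
    field_simp
  have hle : ∀ j ∈ range (n + 1), 0 ≤ rainsDual n A j - A j := by
    intro j hj
    rw [mem_range] at hj
    by_cases hjd : j < d
    · rw [← hAeq j hjd, sub_self]
    · exact sub_nonneg.mpr (hAle j (not_lt.mp hjd) (by omega))
  have hzero : ∑ j ∈ range (n + 1), (rainsDual n A j - A j) = 0 := by
    rw [sum_sub_distrib, hsumA, hsumB, sub_self]
  have hall : ∀ j ∈ range (n + 1), A j = rainsDual n A j := by
    intro j hj
    have := (sum_eq_zero_iff_of_nonneg hle).mp hzero j hj
    linarith
  have hinv : macT n D = D := by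
    ext j
    by_cases hj : j ≤ n
    · rw [hD, coeff_macT_ofCoeffs, coeff_ofCoeffs, if_pos hj, hall j (mem_range.mpr (by omega))]
    · rw [coeff_eq_zero_of_natDegree_lt ((natDegree_macT_le n D).trans_lt (by omega)),
        coeff_eq_zero_of_natDegree_lt (hDdeg.trans_lt (by omega))]
  -- Step 2: the coefficient identity `c_i = Σ_j κ_{ij} a_j = Σ_j β_{ij} b_j` for the invariant `D`.
  have hI : ∀ i, n ≤ 3 * i →
      serFun (psiSeries n i) i D = sumFun (betaW n i) (n % 2) (n / 2) (shT n D) := by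
    intro i hi
    have := invFun_eq_invShadowFun hi hDdeg
    rw [invFun, invShadowFun, LinearMap.comp_apply, LinearMap.comp_apply, LinearMap.comp_apply,
      LinearMap.add_apply, LinearMap.id_apply, hinv, ← two_smul ℝ D, map_smul, map_smul, map_smul, smul_eq_mul,
      smul_eq_mul] at this
    linarith
  have hAside : ∀ i, i < d → serFun (psiSeries n i) i D = PowerSeries.coeff i (psiSeries n i) := by
    intro i hid
    rw [serFun_eq_sum, sum_eq_single 0]
    · rw [hD, coeff_ofCoeffs, if_pos (Nat.zero_le n), hA0, one_mul, Nat.sub_zero]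
    · intro j hj hj0
      rw [mem_range] at hj
      rw [hD, coeff_ofCoeffs]
      split_ifs with hjn
      · rw [hApure j (by omega) (by omega), zero_mul]
      · rw [zero_mul]
    · intro h0; exact absurd (mem_range.mpr (Nat.succ_pos i)) h0
  have hBside : ∀ i, sumFun (betaW n i) (n % 2) (n / 2) (shT n D)
      = ∑ j ∈ range (n / 2 + 1), betaW n i j * rainsShadow n A (2 * j + n % 2) := by
    intro i; rw [sumFun_apply]; simp_rw [hD, coeff_shT_ofCoeffs]
  have hkt : n = 2 * (n / 2) + n % 2 := (Nat.div_add_mod n 2).symm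
  have hSnn : ∀ j ∈ range (n / 2 + 1), 0 ≤ rainsShadow n A (2 * j + n % 2) := by
    intro j hj; rw [mem_range] at hj; exact hS _ (by omega)
  -- write n = 6M − l with 1 ≤ l ≤ 6
  set M := (n + 6) / 6 with hM
  have hM1 : 1 ≤ M := by omega
  have hl : 6 * M - 6 ≤ n ∧ n + 1 ≤ 6 * M := by omega
  by_cases hl1 : n = 6 * M - 1
  · -- `n ≡ 5 (mod 6)`: certificate `c_{2M+1} + 4 c_{2M}`, bound `2M + 1`
    have hbound : 2 * M + 2 ≤ d := by
      have : n % 6 = 5 := by omega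
      rw [if_pos this] at hd; omega
    have hI1 := hI (2 * M) (by omega)
    have hI2 := hI (2 * M + 1) (by omega)
    rw [hAside _ (by omega), hBside] at hI1 hI2
    -- κ₁ = 0
    have hk1 : PowerSeries.coeff (2 * M) (psiSeries n (2 * M)) = 0 := by
      have hbl := coeff_buermannLagrange n (2 * M) (by omega) (by omega)
      rw [show 3 * (2 * M) - n - 1 = 0 by omega, pow_zero, one_mul, show 2 * M - 1 = 2 * (M - 1) + 1 by omega,
        coeff_wSeries_two_mul_add_one, mul_zero] at hbl
      rw [psiSeries]
      have h2M : (0 : ℝ) < (2 * M : ℕ) := by positivity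
      rcases mul_eq_zero.mp hbl with h | h
      · exact absurd h (by positivity)
      · exact h
    -- κ₂ < 0
    have hk2 : PowerSeries.coeff (2 * M + 1) (psiSeries n (2 * M + 1)) < 0 := by
      have hbl := coeff_buermannLagrange n (2 * M + 1) (by omega) (by omega)
      rw [show 3 * (2 * M + 1) - n - 1 = 3 by omega, Nat.add_sub_cancel] at hbl
      have hc : 0 < PowerSeries.coeff (2 * M) ((1 + PowerSeries.X) ^ 3 * wSeries (2 * M)) :=
        coeff_one_add_X_pow_mul_wSeries_pos (Or.inl (even_two_mul M))
      rw [psiSeries]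
      have hn0 : (0 : ℝ) < n := by exact_mod_cast hn
      have h2M : (0 : ℝ) < (2 * M + 1 : ℕ) := by positivity
      nlinarith
    -- the shadow side of `c_{2M+1} + 4c_{2M}` is ≥ 0
    have hB : 0 ≤ (∑ j ∈ range (n / 2 + 1), betaW n (2 * M + 1) j * rainsShadow n A (2 * j + n % 2))
        + 4 * ∑ j ∈ range (n / 2 + 1), betaW n (2 * M) j * rainsShadow n A (2 * j + n % 2) := by
      rw [mul_sum, ← sum_add_distrib]
      refine sum_nonneg fun j hj => ?_
      rw [← mul_assoc, ← add_mul]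
      refine mul_nonneg ?_ (hSnn j hj)
      rw [mem_range] at hj
      rw [betaW, betaW, show 3 * (2 * M + 1) - n = 4 by omega, show 3 * (2 * M) - n = 1 by omega,
        show (-1 : ℝ) ^ (2 * M) = 1 by rw [pow_mul, neg_one_sq, one_pow], pow_succ, pow_mul, neg_one_sq, one_pow,
        one_mul]
      have hc := two_mul_choose_two_mul_add_one_le (N := n / 2 - j) hM1 (by omega)
      have hc' : (2 : ℝ) * ((n / 2 - j).choose (2 * M + 1) : ℕ) ≤ ((n / 2 - j).choose (2 * M) : ℕ) := by
        exact_mod_cast hc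
      linarith
    linarith
  · -- `n ≢ 5 (mod 6)`: certificate `c_{2M}`, bound `2M`
    have hbound : 2 * M + 1 ≤ d := by
      have : n % 6 ≠ 5 := by omega
      rw [if_neg this] at hd; omega
    have hI1 := hI (2 * M) (by omega)
    rw [hAside _ (by omega), hBside] at hI1
    -- κ < 0
    have hk : PowerSeries.coeff (2 * M) (psiSeries n (2 * M)) < 0 := by
      have hbl := coeff_buermannLagrange n (2 * M) (by omega) (by omega)
      have hc : 0 < PowerSeries.coeff (2 * M - 1) ((1 + PowerSeries.X) ^ (3 * (2 * M) - n - 1) * wSeries (2 * M - 1)) :=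
        coeff_one_add_X_pow_mul_wSeries_pos (Or.inr (by omega))
      rw [psiSeries]
      have hn0 : (0 : ℝ) < n := by exact_mod_cast hn
      have h2M : (0 : ℝ) < (2 * M : ℕ) := by positivity
      nlinarith
    have hB : 0 ≤ ∑ j ∈ range (n / 2 + 1), betaW n (2 * M) j * rainsShadow n A (2 * j + n % 2) := by
      refine sum_nonneg fun j hj => mul_nonneg ?_ (hSnn j hj)
      rw [betaW, show (-1 : ℝ) ^ (2 * M) = 1 by rw [pow_mul, neg_one_sq, one_pow]]
      positivity
    linarith

end ShadowBound

/-! ### The three named facts of `WeightEnumeratorBounds.lean`, discharged -/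

/-- **Discharge of `Rains1999_shadowDistanceBound`** (Thm. 15: «If a `((6m−1+l, K, d))` exists for `K > 1`, with
`0 ≤ l ≤ 5`, then `d ≤ 2m+1` (`l < 5`), `d ≤ 2m+2` (`l = 5`)»): by Rains's LP bound `Rains1999_LPBound_holds`
(Thm. 10, proved in `QuantumMacWilliams.lean`) and `rainsLP_shadow_bound`. [cite: Rains1999Shadow, Thm. 15 p. 2365] -/
theorem Rains1999_shadowDistanceBound_holds : Rains1999_shadowDistanceBound := by
  intro n K d P hK hP
  exact ShadowBound.rainsLP_shadow_bound hK (Rains1999_LPBound_holds n K d P hP)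

/-- **Discharge of `Rains1998_theorem9_shadowBound`** (Thm. 9: additive `[[n,k,d]]`, `k ≥ 1`, has `d ≤ 2m+1`,
`n = 6m−1+l`, `l ≤ 4`; `d ≤ 2m+2` for `l = 5`): an `[[n,k,d]]` is realised by an `((n,2^k,d))` projection
(`IsAdditiveCode.exists_isCodeProjection`), `2^k > 1`, and `rainsLP_shadow_bound` applies.
[cite: Rains1998Shadow, §V Thm. 9 p. 138] -/
theorem Rains1998_theorem9_shadowBound_holds : Rains1998_theorem9_shadowBound := by
  rintro n k d hk ⟨S, hS⟩
  obtain ⟨P, hP⟩ := hS.exists_isCodeProjection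
  have hK : 2 ≤ 2 ^ k := by
    calc 2 = 2 ^ 1 := (pow_one 2).symm
      _ ≤ 2 ^ k := Nat.pow_le_pow_right (by norm_num) hk
  exact ShadowBound.rainsLP_shadow_bound hK (Rains1999_LPBound_holds n (2 ^ k) d P hP)

/-- **Discharge of `Rains1998_theorem6_selfDual`** (Thm. 6: a self-dual `[6m+l, 6m+l, d]_4`, i.e. an `[[n,0,d]]`
with `n = 6m+l ≥ 1`, has `d ≤ 2m+2` (`l < 5`), `d ≤ 2m+3` (`l = 5`)): an `[[n,0,d]]` satisfies Rains's pure LP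
with `K = 1` (`IsAdditiveCode.rainsLPFeasiblePure_zero`), and `rainsLPPure_shadow_bound` applies.
[cite: Rains1998Shadow, §IV Thm. 6 p. 138] -/
theorem Rains1998_theorem6_selfDual_holds : Rains1998_theorem6_selfDual := by
  rintro n d hn ⟨S, hS⟩
  exact ShadowBound.rainsLPPure_shadow_bound hn hS.rainsLPFeasiblePure_zero

/-- **Rains's shadow bound for general self-dual quantum codes** (the `K = 1` companion of Thm. 15): «Theorem 14.
If a (pure) `((6m+l,1,d))` exists, with `0 ≤ l ≤ 5`, then `d ≤ 2m+2` (`l < 5`), `d ≤ 2m+3` (`l = 5`).» (The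
clauses «If a `((6m+5,1,2m+3))` exists (necessarily odd), then so does a `((6m+6,1,2m+4))`. Finally, any
`((6m,1,2m+2))` must be even» are not restated.) Written in `n = 6m + l`: `d ≤ 2⌊n/6⌋ + 2`, `+3` when
`n ≡ 5 (mod 6)`; the code is carried by its projection `P` (`IsCodeProjection P 1 d`) with Rains's purity
convention for `K = 1` made explicit (`IsPureToWeight P d`), and with `1 ≤ n` explicit (for `n = 0` purity is
vacuous; same boundary as `Rains1998_theorem6_selfDual`). Proof: Rains's pure LP (`Rains1999_LPBound_pure_holds`)
and `rainsLPPure_shadow_bound` — «the proof makes no assumptions of integrality, so carries over directly».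
Column: proved. [cite: Rains1999Shadow, Thm. 14 p. 2365] -/
theorem Rains1999_theorem14_pureSelfDual (n d : ℕ) (P : Matrix (Fin n → Bool) (Fin n → Bool) ℂ) (hn : 1 ≤ n)
    (hP : IsCodeProjection P 1 d) (hpure : IsPureToWeight P d) :
    d ≤ 2 * (n / 6) + (if n % 6 = 5 then 3 else 2) :=
  ShadowBound.rainsLPPure_shadow_bound hn (Rains1999_LPBound_pure_holds n 1 d P hP hpure)

/-- **«In particular, any quantum code of length `n` can correct at most `⌊(n+1)/6⌋` errors.»** — the closing clause
of Thm. 15: for every `((n,K,d))` with `K > 1`, the number of correctable errors `t = ⌊(d−1)/2⌋` satisfies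
`t ≤ ⌊(n+1)/6⌋` (both cases `d ≤ 2⌊(n+1)/6⌋ + 1` and `d ≤ 2⌊(n+1)/6⌋ + 2` of `Rains1999_shadowDistanceBound` give
it). Column: proved. [cite: Rains1999Shadow, Thm. 15 p. 2365 («In particular» clause)] -/
theorem Rains1999_theorem15_correctableErrors (n K d : ℕ) (P : Matrix (Fin n → Bool) (Fin n → Bool) ℂ)
    (hK : 1 < K) (hP : IsCodeProjection P K d) : (d - 1) / 2 ≤ (n + 1) / 6 := by
  have h := Rains1999_shadowDistanceBound_holds n K d P hK hP
  split_ifs at h <;> omega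

end

end Literature.InformationTheory.QuantumCodes
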